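import Literature.RepresentationTheory.FiniteGroups.InvariantLineOfFixedVectors
import HarnessLib

/-!
# BSD rank-≤1 residual cell: a normal subgroup all of whose elements have the eigenvalue `1`
# (plane representations) acts trivially or forces an invariant line

HONEST FRAMING (cell `b2b-bsdres-*`, run/shared/lean/b2b/bsd-rank1-residual/, verbatim): the goal
of the cell is to DELETE the COMBINATION-SHAPED residual classes for ALL analytic-rank `≤ 1` elliptic
curves over `ℚ` — "full BSD formula for every rank `≤ 1` curve in class C" assembled STRICTLY from
published theorems — so that the rank-`≤ 1` remainder becomes exactly the CONSTRUCTION-SHAPED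
classes, which are TYPED (missing-input Props), NOT attempted; this is not "finishing BSD".
Prove what is provable now; shrink each hard class to its core with data; no claim beyond stated
classes.  Research routes; census output = EVIDENCE, never a Literature fact.  Unit
`b2b-bsdres-n1011-p09` (team n1011, ROUTE-1 sub-target R1-8 (ii), OWNERS row **T-R18b**, step S-A of
`cells/n1011/skel/T-R18b.md`).  THEOREMS ONLY (no definition, no named fact, no instance); a TOOL
file of linear algebra in dimension `2` — no closure value, no class theorem, no label moves.

## What this file does

The RELATIVE form of the tree's invariant-line lemma
`Literature.RepresentationTheory.FiniteGroups.Representation.exists_finrank_eq_one_invariant_of_forall_exists_fixed`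
("a plane representation all of whose elements fix a non-zero vector has an invariant line").  Let
`ρ : G → GL(V)` be a representation on a plane `V` over a field `k` and `H ⊴ G` a normal subgroup
such that **every `ρ h`, `h ∈ H`, has the eigenvalue `1`**.  Then EITHER `ρ(H) = 1` OR some line of
`V` is stable under the WHOLE of `G` (`forall_eq_one_or_exists_invariant_line_of_normal`).  So if `ρ`
is irreducible, `H` acts trivially.

This is the group theory behind step S-B of T-R18b: for `E/ℚ` with `E[p]` irreducible, `p` odd, and
`H = Gal(\bar ℚ/ℚ(μ_M))`, NOT every element of `ρ̄_{E,p}(H)` can have the eigenvalue `1` (else `H`,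
which contains the commutator subgroup, would act trivially on `E[p]`, contradicting the cell's
T-R18a `GaloisImage.geomTorsion_eq_zero_of_commutator_fixed_of_irreducible`); a Frobenius in such a
class is a prime `ℓ ≡ 1 (mod M)` with `a_ℓ(E) ≢ ℓ + 1 (mod p)` — the prime that makes Drinfeld's
operator `T_ℓ − ℓ − 1` a `p`-adic unit on the newform while killing every cuspidal divisor
(file `Additive/PlusSymbolIntegrality.lean`).

Proof (both cases reuse the Literature file's lemmas):
* (`line_eq_ker_of_unipotent_of_invariant`, unipotent case) if some `u = ρ h₁ ≠ 1`, `h₁ ∈ H`, is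
  unipotent, its fixed line `L = ker(u − 1)` is `H`-stable (`apply_mem_ker_of_unipotent` for `ρ|_H`)
  and is the ONLY `H`-stable line (a `u`-stable line is an eigenline of `u`, whose only eigenvalue is
  `1`); since `ρ g (L)` is again `H`-stable by normality, `ρ g (L) = L`.
* (`apply_eq_self_of_commute_of_forall_exists_fixed`, semisimple case) if `ρ(H)` has no unipotent
  `≠ 1`, its determinant-one elements are trivial (`mul_self_sub_one_eq_zero_of_det_eq_one`), so
  `ρ(H)` is abelian; if `ρ h₀ ≠ 1` then EVERY `ρ h`, `h ∈ H`, fixes the line `L = ker(ρ h₀ − 1)`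
  pointwise (otherwise, in the basis `(e, v)` with `e ∈ L`, `ρ h v = v`, one gets `ρ h = diag(c, 1)`,
  `ρ h₀ = diag(1, a)` with `c, a ≠ 1`, and `ρ(h₀h) = diag(c, a)` has no fixed vector), whence
  `ρ h₀ (ρ g x) = ρ g (ρ(g⁻¹ h₀ g) x) = ρ g x` for `x ∈ L`: `L` is `G`-stable.
* `exists_fixed_or_exists_stable_addSubgroup_of_natCard_eq_sq`: the Galois-module form (an
  `𝔽_p`-module `A` with `p²` elements, `Γ` acting by additive automorphisms, `H ⊴ Γ`), the shape
  consumed on `A = E[p]`.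

## References

* J.-P. Serre, *Propriétés galoisiennes des points d'ordre fini des courbes elliptiques*, Invent.
  Math. 15 (1972) 259–331, §2 (subgroups of `GL₂(𝔽_p)`). [Serre1972]
* Tree: `Literature/RepresentationTheory/FiniteGroups/InvariantLineOfFixedVectors.lean` (the
  absolute case, DDT 1995 Prop. 2.6(b) substitute).
* Cell files: `cells/n1011/skel/T-R18b.md` S-A; `cells/n1011/ROUTE-1.md` §15.4 R1-8.
-/

open Module

namespace Summit.BirchSwinnertonDyer.Rank1Residual.GaloisImage

open Literature.RepresentationTheory.FiniteGroups.Representation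

variable {k V G : Type*} [Field k] [AddCommGroup V] [Module k V] [Group G]

/-! ### Two vectors spanning a plane -/

/-- If `T e = c • e` with `c ≠ 1`, `e ≠ 0`, and `T v = v` with `v ≠ 0`, then `e, v` are linearly
independent (eigenvectors for the distinct eigenvalues `c ≠ 1`). [folklore] -/
theorem linearIndependent_pair_of_eigen {T : Module.End k V} {e v : V} {c : k} (he : e ≠ 0)
    (hv : v ≠ 0) (hc : c ≠ 1) (hTe : T e = c • e) (hTv : T v = v) :
    LinearIndependent k ![e, v] := by
  refine LinearIndependent.pair_iff.mpr fun s t hst ↦ ?_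
  -- apply `T`: `s c • e + t • v = 0`; subtract: `s (c - 1) • e = 0`
  have h1 : T (s • e + t • v) = 0 := by rw [hst, map_zero]
  rw [map_add, map_smul, map_smul, hTe, hTv, smul_smul] at h1
  have h2 : (s * c - s) • e = 0 := by
    have : (s * c) • e + t • v - (s • e + t • v) = 0 := by rw [h1, hst, sub_zero]
    rwa [add_sub_add_right_eq_sub, ← sub_smul] at this
  have hs : s = 0 := by
    rcases smul_eq_zero.mp h2 with h | h
    · have : s * (c - 1) = 0 := by rw [mul_sub, mul_one]; exact h
      rcases mul_eq_zero.mp this with h' | h'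
      · exact h'
      · exact absurd (sub_eq_zero.mp h') hc
    · exact absurd h he
  rw [hs, zero_smul, zero_add] at hst
  rcases smul_eq_zero.mp hst with h | h
  · exact ⟨hs, h⟩
  · exact absurd h hv

/-- In a plane, two linearly independent vectors span: every `w` is `a • e + b • v`. [folklore] -/
theorem exists_eq_add_smul_of_linearIndependent_pair (h2 : finrank k V = 2) {e v : V}
    (hli : LinearIndependent k ![e, v]) (w : V) : ∃ a b : k, w = a • e + b • v := by
  have hspan := hli.span_eq_top_of_card_eq_finrank (by rw [h2]; rfl)
  have hw : w ∈ Submodule.span k (Set.range ![e, v]) := by rw [hspan]; exact Submodule.mem_top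
  obtain ⟨c, hc⟩ := (Submodule.mem_span_range_iff_exists_fun k).mp hw
  refine ⟨c 0, c 1, ?_⟩
  rw [← hc, Fin.sum_univ_two]
  rfl

/-! ### The unipotent case: the fixed line of a unipotent is the only stable line -/

/-- **A line stable under a unipotent `u ≠ 1` of a plane is its fixed line `ker(u − 1)`**: the
line is an eigenline of `u`, and the only eigenvalue of `u` is `1` (`(c − 1)² = 0 ⇒ c = 1`).
[folklore] -/
theorem line_eq_ker_of_unipotent_of_invariant (h2 : finrank k V = 2) {u : Module.End k V}
    (hne : u ≠ 1) (hsq : (u - 1) * (u - 1) = 0) {L : Submodule k V} (hL : finrank k L = 1)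
    (hstab : ∀ x ∈ L, u x ∈ L) : L = LinearMap.ker (u - 1) := by
  haveI : FiniteDimensional k V := Module.finite_of_finrank_eq_succ h2
  obtain ⟨_, hK1⟩ := range_eq_ker_of_mul_self_eq_zero h2 (sub_ne_zero.mpr hne) hsq
  -- a generator `x` of `L`
  obtain ⟨⟨x, hxL⟩, hx0, hgen⟩ := finrank_eq_one_iff'.mp hL
  have hx0' : x ≠ 0 := fun h ↦ hx0 (Subtype.ext h)
  -- `u x = c • x`
  obtain ⟨c, hc⟩ := hgen ⟨u x, hstab x hxL⟩
  have hc' : u x = c • x := by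
    have := congr_arg Subtype.val hc
    simpa using this.symm
  -- `(u - 1)² x = (c - 1)² • x = 0`
  have h1 : (u - 1) x = (c - 1) • x := by
    rw [LinearMap.sub_apply, Module.End.one_apply, hc', sub_smul, one_smul]
  have h2' : ((c - 1) * (c - 1)) • x = 0 := by
    have := congr_arg (fun T : Module.End k V ↦ T x) hsq
    simpa only [Module.End.mul_apply, h1, map_smul, smul_smul, LinearMap.zero_apply] using this
  have hc1 : c = 1 := by
    rcases smul_eq_zero.mp h2' with h | h
    · exact sub_eq_zero.mp (mul_self_eq_zero.mp h)
    · exact absurd h hx0'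
  have hxK : x ∈ LinearMap.ker (u - 1) := by
    rw [LinearMap.mem_ker, h1, hc1, sub_self, zero_smul]
  exact eq_of_finrank_eq_one_of_mem hL hK1 hx0' hxL hxK

/-! ### The semisimple case: two commuting elements with eigenvalue `1` -/

/-- **Key computation of the abelian case.** Let `S, T` be commuting endomorphisms of a plane,
`S e = e ≠ 0`, `T e = c • e`, and suppose `T` and `S T` both have a non-zero fixed vector while
`S ≠ 1`.  Then `c = 1`, i.e. `T` fixes `e`.  (Otherwise in the basis `(e, v)`, `T v = v`, one has
`T = diag(c, 1)`, `S = diag(1, a)` with `a ≠ 1`, and `S T = diag(c, a)` fixes nothing.)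
[folklore] -/
theorem apply_eq_self_of_commute_of_forall_exists_fixed (h2 : finrank k V = 2)
    {S T : Module.End k V} (hcomm : S * T = T * S) (hS : S ≠ 1) {e : V} (he : e ≠ 0)
    (hSe : S e = e) {c : k} (hTe : T e = c • e) (hT : ∃ v : V, v ≠ 0 ∧ T v = v)
    (hST : ∃ w : V, w ≠ 0 ∧ (S * T) w = w) : T e = e := by
  by_contra hne
  have hc : c ≠ 1 := by rintro rfl; exact hne (by rw [hTe, one_smul])
  obtain ⟨v, hv0, hTv⟩ := hT
  obtain ⟨w, hw0, hSTw⟩ := hST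
  have hli := linearIndependent_pair_of_eigen he hv0 hc hTe hTv
  have hpair := LinearIndependent.pair_iff.mp hli
  -- `S v` is `T`-fixed, hence `S v = β • v`
  obtain ⟨α, β, hSv⟩ := exists_eq_add_smul_of_linearIndependent_pair h2 hli (S v)
  have hTSv : T (S v) = S v := by
    rw [← Module.End.mul_apply, ← hcomm, Module.End.mul_apply, hTv]
  have hα : α = 0 := by
    have h1 : T (S v) - S v = 0 := sub_eq_zero.mpr hTSv
    rw [hSv, map_add, map_smul, map_smul, hTe, hTv, smul_smul] at h1
    have h3 : (α * c - α) • e + (0 : k) • v = 0 := by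
      rw [zero_smul, add_zero, sub_smul]
      have : (α * c) • e + β • v - (α • e + β • v) = (α * c) • e - α • e := by abel
      rw [← this, h1]
    have := (hpair _ _ h3).1
    have h4 : α * (c - 1) = 0 := by rw [mul_sub, mul_one]; exact this
    rcases mul_eq_zero.mp h4 with h | h
    · exact h
    · exact absurd (sub_eq_zero.mp h) hc
  rw [hα, zero_smul, zero_add] at hSv
  -- `β ≠ 1` since `S ≠ 1`
  have hβ : β ≠ 1 := by
    rintro rfl
    rw [one_smul] at hSv
    apply hS
    apply LinearMap.ext
    intro x
    obtain ⟨a, b, rfl⟩ := exists_eq_add_smul_of_linearIndependent_pair h2 hli x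
    rw [map_add, map_smul, map_smul, hSe, hSv, Module.End.one_apply]
  -- the fixed vector `w = a • e + b • v` of `S T` must vanish
  obtain ⟨a, b, hw⟩ := exists_eq_add_smul_of_linearIndependent_pair h2 hli w
  have h1 : (S * T) w - w = 0 := sub_eq_zero.mpr hSTw
  rw [hw, Module.End.mul_apply, map_add, map_smul, map_smul, hTe, hTv, map_add, map_smul,
    map_smul, map_smul, hSe, hSv, smul_smul, smul_smul] at h1
  have h3 : (a * c - a) • e + (b * β - b) • v = 0 := by
    rw [sub_smul, sub_smul]
    have : (a * c) • e + (b * β) • v - (a • e + b • v) =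
        (a * c) • e - a • e + ((b * β) • v - b • v) := by abel
    rw [← this, h1]
  obtain ⟨ha, hb⟩ := hpair _ _ h3
  have ha' : a = 0 := by
    have : a * (c - 1) = 0 := by rw [mul_sub, mul_one]; exact ha
    rcases mul_eq_zero.mp this with h | h
    · exact h
    · exact absurd (sub_eq_zero.mp h) hc
  have hb' : b = 0 := by
    have : b * (β - 1) = 0 := by rw [mul_sub, mul_one]; exact hb
    rcases mul_eq_zero.mp this with h | h
    · exact h
    · exact absurd (sub_eq_zero.mp h) hβ
  rw [ha', hb', zero_smul, zero_smul, add_zero] at hw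
  exact hw0 hw

/-! ### The relative invariant-line theorem -/

/-- The image of a line under `ρ g` is a line. [folklore] -/
theorem finrank_map_eq_of_rep (ρ : _root_.Representation k G V) (g : G) (L : Submodule k V) :
    finrank k (L.map (ρ g)) = finrank k L := by
  have hinv1 : ∀ x, ρ g (ρ g⁻¹ x) = x := fun x ↦ by
    rw [← Module.End.mul_apply, ← map_mul, mul_inv_cancel, map_one, Module.End.one_apply]
  have hinv2 : ∀ x, ρ g⁻¹ (ρ g x) = x := fun x ↦ by
    rw [← Module.End.mul_apply, ← map_mul, inv_mul_cancel, map_one, Module.End.one_apply]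
  let e : V ≃ₗ[k] V :=
    LinearEquiv.ofLinear (ρ g) (ρ g⁻¹) (LinearMap.ext hinv1) (LinearMap.ext hinv2)
  have he : L.map (ρ g) = L.map (e : V →ₗ[k] V) := rfl
  rw [he, LinearEquiv.finrank_map_eq]

/-- **A normal subgroup all of whose elements have the eigenvalue `1` acts trivially or forces an
invariant line.**  Let `k` be a field, `V` a `k`-plane, `ρ : Representation k G V`, and `H ⊴ G` a
normal subgroup such that every `ρ h`, `h ∈ H`, fixes a non-zero vector.  Then either `ρ h = 1` for
all `h ∈ H`, or there is a line `L ⊆ V` with `ρ g (L) ⊆ L` for ALL `g ∈ G`.  (Unipotent case: the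
fixed line of a unipotent `ρ h₁ ≠ 1` is the unique `H`-stable line, and `ρ g (L)` is `H`-stable by
normality.  Semisimple case: `ρ(H)` is abelian and fixes `ker(ρ h₀ − 1)` pointwise, a line which is
then `G`-stable.)  The absolute case `H = G` is the Literature file's
`exists_finrank_eq_one_invariant_of_forall_exists_fixed`. [folklore] -/
theorem forall_eq_one_or_exists_invariant_line_of_normal (ρ : _root_.Representation k G V)
    (h2 : finrank k V = 2) (H : Subgroup G) [hN : H.Normal]
    (hfix : ∀ h ∈ H, ∃ v : V, v ≠ 0 ∧ ρ h v = v) :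
    (∀ h ∈ H, ρ h = 1) ∨
      ∃ L : Submodule k V, finrank k L = 1 ∧ ∀ g : G, ∀ x ∈ L, ρ g x ∈ L := by
  classical
  haveI : FiniteDimensional k V := Module.finite_of_finrank_eq_succ h2
  -- conjugation into `H`
  have hconj : ∀ (g : G) (h : G), h ∈ H → g⁻¹ * h * g ∈ H := fun g h hh ↦ by
    have := hN.conj_mem h hh g⁻¹
    rwa [inv_inv] at this
  -- `ρ h₀ ∘ ρ g = ρ g ∘ ρ (g⁻¹ h₀ g)`
  have hrel : ∀ (g h₀ : G) (x : V), ρ h₀ (ρ g x) = ρ g (ρ (g⁻¹ * h₀ * g) x) := fun g h₀ x ↦ by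
    rw [← Module.End.mul_apply, ← Module.End.mul_apply, ← map_mul, ← map_mul]
    congr 2
    group
  -- the restriction of `ρ` to `H`
  let ρH : _root_.Representation k H V := (ρ : G →* Module.End k V).comp H.subtype
  have hρH : ∀ h : H, ρH h = ρ (h : G) := fun h ↦ rfl
  have hfixH : ∀ h : H, ∃ v : V, v ≠ 0 ∧ ρH h v = v := fun h ↦ hfix h h.2
  by_cases hU : ∃ h ∈ H, ρ h ≠ 1 ∧ (ρ h - 1) * (ρ h - 1) = 0
  · -- unipotent case
    obtain ⟨h₁, hh₁, hne, hsq⟩ := hU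
    right
    have hK1 := (range_eq_ker_of_mul_self_eq_zero h2 (sub_ne_zero.mpr hne) hsq).2
    refine ⟨LinearMap.ker (ρ h₁ - 1), hK1, fun g x hx ↦ ?_⟩
    -- `M = ρ g (L)` is an `H`-stable line, hence `= L`
    set M : Submodule k V := (LinearMap.ker (ρ h₁ - 1)).map (ρ g) with hM
    have hM1 : finrank k M = 1 := by rw [hM, finrank_map_eq_of_rep, hK1]
    have hHL : ∀ h ∈ H, ∀ y ∈ LinearMap.ker (ρ h₁ - 1), ρ h y ∈ LinearMap.ker (ρ h₁ - 1) := by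
      intro h hh y hy
      have hne' : ρH ⟨h₁, hh₁⟩ ≠ 1 := hne
      have hsq' : (ρH ⟨h₁, hh₁⟩ - 1) * (ρH ⟨h₁, hh₁⟩ - 1) = 0 := hsq
      exact apply_mem_ker_of_unipotent ρH h2 hfixH hne' hsq' ⟨h, hh⟩ y hy
    have hMstab : ∀ y ∈ M, ρ h₁ y ∈ M := by
      rintro _ ⟨y, hy, rfl⟩
      refine ⟨ρ (g⁻¹ * h₁ * g) y, hHL _ (hconj g h₁ hh₁) y hy, ?_⟩
      exact (hrel g h₁ y).symm
    have hML : M = LinearMap.ker (ρ h₁ - 1) :=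
      line_eq_ker_of_unipotent_of_invariant h2 hne hsq hM1 hMstab
    rw [← hML]
    exact Submodule.mem_map_of_mem hx
  · -- semisimple case: no unipotent `≠ 1` in `ρ(H)`
    push Not at hU
    by_cases htriv : ∀ h ∈ H, ρ h = 1
    · exact Or.inl htriv
    right
    push Not at htriv
    obtain ⟨h₀, hh₀, hne₀⟩ := htriv
    -- determinant-one elements of `ρ(H)` are trivial, so `ρ(H)` is abelian
    have hdet1 : ∀ h ∈ H, LinearMap.det (ρ h) = 1 → ρ h = 1 := by
      intro h hh hd
      by_contra hne
      obtain ⟨v, hv0, hv⟩ := hfix h hh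
      exact hU h hh hne (mul_self_sub_one_eq_zero_of_det_eq_one h2 hd hv0 hv)
    have hdetinv : ∀ g : G, LinearMap.det (ρ g) * LinearMap.det (ρ g⁻¹) = 1 := fun g ↦ by
      rw [← map_mul, ← map_mul, mul_inv_cancel, map_one, map_one]
    have hcomm : ∀ h ∈ H, ∀ h' ∈ H, ρ h * ρ h' = ρ h' * ρ h := by
      intro h hh h' hh'
      have hc : ρ (h * h' * h⁻¹ * h'⁻¹) = 1 := by
        apply hdet1 _ (H.mul_mem (H.mul_mem (H.mul_mem hh hh') (H.inv_mem hh)) (H.inv_mem hh'))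
        simp only [map_mul]
        calc LinearMap.det (ρ h) * LinearMap.det (ρ h') * LinearMap.det (ρ h⁻¹) *
              LinearMap.det (ρ h'⁻¹)
            = (LinearMap.det (ρ h) * LinearMap.det (ρ h⁻¹)) *
              (LinearMap.det (ρ h') * LinearMap.det (ρ h'⁻¹)) := by ring
          _ = 1 := by rw [hdetinv, hdetinv, mul_one]
      calc ρ h * ρ h' = ρ (h * h') := (map_mul ρ h h').symm
        _ = ρ (h * h' * h⁻¹ * h'⁻¹ * (h' * h)) := by congr 1; group
        _ = ρ h' * ρ h := by rw [map_mul, hc, one_mul, map_mul]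
    -- the line `L = ker(ρ h₀ - 1)`
    have hmem : ∀ x, x ∈ LinearMap.ker (ρ h₀ - 1) ↔ ρ h₀ x = x := fun x ↦ by
      rw [LinearMap.mem_ker, LinearMap.sub_apply, Module.End.one_apply, sub_eq_zero]
    have hL1 : finrank k (LinearMap.ker (ρ h₀ - 1)) = 1 := by
      obtain ⟨v, hv0, hv⟩ := hfix h₀ hh₀
      refine finrank_eq_one_of_ne_bot_of_ne_top h2 (fun h ↦ hv0 ?_) (fun h ↦ hne₀ ?_)
      · have hv' := (hmem v).mpr hv
        rw [h] at hv'
        exact (Submodule.mem_bot k).mp hv'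
      · rw [← sub_eq_zero, ← LinearMap.ker_eq_top]
        exact h
    -- every `h ∈ H` fixes `L` pointwise
    have hfixL : ∀ h ∈ H, ∀ x ∈ LinearMap.ker (ρ h₀ - 1), ρ h x = x := by
      intro h hh x hx
      by_cases hx0 : x = 0
      · rw [hx0, map_zero]
      have hSe : ρ h₀ x = x := (hmem x).mp hx
      -- `ρ h x ∈ L = k ∙ x`
      have hhx : ρ h x ∈ LinearMap.ker (ρ h₀ - 1) := by
        rw [hmem, ← Module.End.mul_apply, hcomm h₀ hh₀ h hh, Module.End.mul_apply, hSe]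
      have hspan : LinearMap.ker (ρ h₀ - 1) = k ∙ x :=
        (eq_of_finrank_eq_one_of_mem (finrank_span_singleton hx0) hL1 hx0
          (Submodule.mem_span_singleton_self x) hx).symm
      rw [hspan, Submodule.mem_span_singleton] at hhx
      obtain ⟨c, hc⟩ := hhx
      exact apply_eq_self_of_commute_of_forall_exists_fixed h2 (hcomm h₀ hh₀ h hh) hne₀ hx0 hSe
        hc.symm (hfix h hh) (by rw [← map_mul]; exact hfix (h₀ * h) (H.mul_mem hh₀ hh))
    refine ⟨LinearMap.ker (ρ h₀ - 1), hL1, fun g x hx ↦ ?_⟩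
    rw [hmem, hrel g h₀ x, hfixL _ (hconj g h₀ hh₀) x hx]

/-- Variant: under the same hypotheses, either all of `H` has a COMMON non-zero fixed vector, or
some line is `G`-stable. [folklore] -/
theorem exists_common_fixed_or_exists_invariant_line_of_normal (ρ : _root_.Representation k G V)
    (h2 : finrank k V = 2) (H : Subgroup G) [H.Normal]
    (hfix : ∀ h ∈ H, ∃ v : V, v ≠ 0 ∧ ρ h v = v) :
    (∃ v : V, v ≠ 0 ∧ ∀ h ∈ H, ρ h v = v) ∨
      ∃ L : Submodule k V, finrank k L = 1 ∧ ∀ g : G, ∀ x ∈ L, ρ g x ∈ L := by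
  rcases forall_eq_one_or_exists_invariant_line_of_normal ρ h2 H hfix with h | h
  · left
    haveI : Nontrivial V := Module.nontrivial_of_finrank_pos (R := k) (by omega)
    obtain ⟨v, hv0⟩ := exists_ne (0 : V)
    exact ⟨v, hv0, fun g hg ↦ by rw [h g hg, Module.End.one_apply]⟩
  · exact Or.inr h

/-! ### Galois-module form -/

section ZModPlane

variable {p : ℕ} [Fact p.Prime] {A : Type*} [AddCommGroup A] [Module (ZMod p) A]
  {Γ : Type*} [Group Γ] [DistribMulAction Γ A]

/-- **Galois-module form.** Let `A` be an `𝔽_p`-plane with an action of `Γ` by additive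
automorphisms (e.g. `A = E[p]`) and `H ⊴ Γ` a normal subgroup every element of which fixes a
non-zero element of `A`.  Then either `H` has a COMMON non-zero fixed element, or `A` has a
`Γ`-stable subgroup other than `⊥` and `⊤` (so `A` is a reducible `Γ`-module in the sense of
`WeierstrassCurve.HasIrreducibleModPGaloisRep`). [folklore] -/
theorem exists_fixed_or_exists_stable_addSubgroup_of_finrank_eq_two (h2 : finrank (ZMod p) A = 2)
    (H : Subgroup Γ) [H.Normal] (hfix : ∀ σ ∈ H, ∃ a : A, a ≠ 0 ∧ σ • a = a) :
    (∃ a : A, a ≠ 0 ∧ ∀ σ ∈ H, σ • a = a) ∨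
      ∃ B : AddSubgroup A, (∀ σ : Γ, ∀ a ∈ B, σ • a ∈ B) ∧ B ≠ ⊥ ∧ B ≠ ⊤ := by
  let ρ : _root_.Representation (ZMod p) Γ A :=
    { toFun := fun σ ↦ (DistribSMul.toAddMonoidHom A σ).toZModLinearMap p
      map_one' := by ext; simp
      map_mul' := fun σ τ ↦ by ext; simp [mul_smul] }
  have hρ : ∀ (σ : Γ) (a : A), ρ σ a = σ • a := fun σ a ↦ rfl
  have hfix' : ∀ σ ∈ H, ∃ a : A, a ≠ 0 ∧ ρ σ a = a := hfix
  rcases exists_common_fixed_or_exists_invariant_line_of_normal ρ h2 H hfix' with h | ⟨L, hL1, hL⟩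
  · exact Or.inl h
  · right
    obtain ⟨hbot, htop⟩ := ne_bot_and_ne_top_of_finrank_eq_one h2 hL1
    refine ⟨L.toAddSubgroup, fun σ a ha ↦ hL σ a ha, fun h ↦ hbot ?_, fun h ↦ htop ?_⟩
    · rw [← Submodule.toAddSubgroup_inj, h, Submodule.bot_toAddSubgroup]
    · exact Submodule.toAddSubgroup_eq_top.mp h

/-- **Galois-module form, cardinality version**: an `𝔽_p`-module `A` with `p²` elements acted on
by `Γ` through additive automorphisms, `H ⊴ Γ` with every element of `H` fixing a non-zero element:
either `H` has a common non-zero fixed element or `A` has a `Γ`-stable subgroup `≠ ⊥, ⊤`.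
[folklore] -/
theorem exists_fixed_or_exists_stable_addSubgroup_of_natCard_eq_sq (hA : Nat.card A = p ^ 2)
    (H : Subgroup Γ) [H.Normal] (hfix : ∀ σ ∈ H, ∃ a : A, a ≠ 0 ∧ σ • a = a) :
    (∃ a : A, a ≠ 0 ∧ ∀ σ ∈ H, σ • a = a) ∨
      ∃ B : AddSubgroup A, (∀ σ : Γ, ∀ a ∈ B, σ • a ∈ B) ∧ B ≠ ⊥ ∧ B ≠ ⊤ :=
  exists_fixed_or_exists_stable_addSubgroup_of_finrank_eq_two (finrank_eq_two_of_natCard_eq_sq hA)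
    H hfix

end ZModPlane

end Summit.BirchSwinnertonDyer.Rank1Residual.GaloisImage
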